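import Summits.QuantumFields.YangMills.Theorems.BalabanUVNodesN16SheetDatumPreimage
import Summits.QuantumFields.YangMills.Theorems.BalabanUVNodesN16SupKeyLetterFloor
import Summits.QuantumFields.BalabanUV.T4Continuum.Support.MinimalActionExistence
import HarnessLib

/-!
# Balaban UV nodes, N16 width lane (N07 → N16 in-edge), file 22d: THE FLOOR OF THE SUP KEY's GRADIENT LETTER, L-UNIFORMLY — existence of run-1
# minimisers at the sheet datum from an explicit smooth preimage (`6 ≤ C.B₃` replaces file 22b's `L² ≤ C.B₃`)

Explicit-unit helper of lineage `pub-ymgap-dag-n16-w1` (generation 8), cell `pub-ymgap`, keyed to K3⁸ `stmt-QuantumFields-27366`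
(`SpineGivenEndpointR13SepCoPHV`, skeleton v6 b4e55110ab73e679).  `--kind proof --supports stmt-QuantumFields-27366 --as helper`.
COUNT-NEUTRAL: no statement item is closed, no stub of the v6 skeleton (`stub_rates13HV`, `stub_expansion13HV`) is named or discharged, node N07
and node N16 are NOT discharged here.

## What is proved (sorry-free, classical axioms only, THEOREMS ONLY — 0 `def`)

* §4 `hol_plaqWord_graded` (the plaquettes of the graded sheet field of file 22c are the INCREMENTS of its profile), `smallField_graded`, `isPeriodicCfg_graded`,
  `mem_sfClass_one_graded` (unitarity by pub-balaban's `isUnitaryCfg_scalarCfg_imag`, as in dag-n16-w2's `isUnitaryCfg_landau`).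
* §5 ★★ `rescale_bavg_graded_sheetEqs`: with the block-parabola profile of amplitude `h` the one-step average (43) of the graded sheet field SOLVES FILE 22a's
  SHEET EQUATIONS for `(N, e₀, e₁, w = e^{iφ}·1)`, `φ = h(L³ − L)∕6`, EXACTLY — the `e₀`-bond average is `1` because the profile vanishes at every block
  start (no coarse gauge), the `e₁`-bond average is the block sum; ★ `mem_admissible_graded`: the field is ADMISSIBLE for the sheet datum at every class
  radius `ρ ≥ h(L−1)L²`.
* §6 ★★ `exists_isMinimiser_sheet`: for `L ≥ 2`, `0 ≤ φ ≤ 1∕32` and every class radius `ρ ≥ 6φ` in leaf-05's series regime, a solution of the sheet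
  equations with `w = e^{iφ}·1` CARRIES A RUN-1 MINIMISER over `sfClass (d+2) L N ρ 1` (preimage radius `6φL∕(L+1) < 6φ`; compactness
  `MinimalActionExistence.exists_isMinimiser_of_nonempty`) — compare dag-n16-w2's `…N16SlotKeyFlatModuli.exists_isMinimiser_inflated` (radius `φL²`).
* §7 ★★ `one_le_of_supKey_runOne_of_six_le` ∕ `supKey_letter_floor_of_six_le` ∕ `not_supKey_of_lt_floor_of_six_le` ∕ `not_supKey_dim_four_of_lt`: **THE FLOOR, L-UNIFORMLY** — in dimension
  `d + 2`, for `L ≥ 2`, `N ≥ 3` and constants with `6 ≤ C.B₃`, the `k = 0` instance of the sup key supKey(C, c) forces `1 ≤ (4(d+2)+9)·c`; so the displayed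
  N07-edge hypothesis is FALSE for every `c < 1∕(4(d+2)+9)` as soon as `C.B₃ ≥ 6` (at the record `d + 2 = 4`: `c ≥ 1∕25`), closing file 22b's escape
  `C.B₃ ∈ [6, L²)` — a `stub_supKey` witness with a k-uniform (8)-radius `B₃ ≥ 6` must carry `c ≥ 1∕25`.  Mechanism = file 22b's
  `dev_le_of_adjacent_of_covariantStep` fed with §6's minimiser; `ε₁ → 0⁺` through `2 sin(ε₁∕2) ≥ ε₁ − ε₁³∕16`.

HONEST FRAMING.  Kernel facts about the LETTER of the displayed hypothesis supKey (node N07's content = [Balaban1985Variational] Thm 1 (8)+(10) at the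
(42)-objects, uniformly in `k`); supKey NOT proved, NOT refuted at any `c ≥ 1∕(4(d+2)+9)` or any `C.B₃ < 6`; nothing of Bałaban asserted or refuted
(print's (10)-letter `B₃M` and (8)-radius `72d³L³B₀` are far above both thresholds); no stub of K3⁸ v6 named or closed; N16 ∕ N07 NOT discharged; counts of
record unmoved (typed 28∕28 · discharged 5∕28); one finite four-torus at fixed `ε` — NOT ℝ⁴, NOT infinite volume, NOT OS, NOT a mass gap; the YM mass gap
(Clay) is NOT proved by any of this — R4 closes the conditional finite-𝕋⁴ rung `BalabanLadder.UV` only.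

Sources: [Balaban1985Averaging] Prop. 1, (42)–(51) pp. 23–26; [Balaban1985Variational] Thm 1 (8)–(10) p. 279.
-/
set_option autoImplicit false

open scoped BigOperators Matrix Matrix.Norms.L2Operator
open NormedSpace Finset

namespace Summit.QuantumFields.YangMills.BalabanUVNodes.N16SupKeyLetterFloorUniform

open Literature.MathematicalPhysics.QuantumFieldTheory.Balaban1983to89
open B7Prop1Explicit B7Prop2Explicit MatrixLog UnitaryModel
open T4AveragingDeficitWall hiding Site Plane Plaq Bond
open T4AveragingDeficitWallBoundary (IsPeriodicCfg scalarCfg hol_scalarCfg val_hol_scalarCfg Xi bavg_scalarCfg add_e_apply_zero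
  add_zsmul_e_apply_zero add_e_zero_apply_zero add_zsmul_e_zero_apply_zero fin_one_ne_zero fin_zero_ne_one norm_real_mul_I smul_one_mem_unitary)
open FederbushMean (cexp_smul_one norm_smul_one_sub_one)
open Summit.QuantumFields.BalabanUV.T4Continuum
open AveragingDeficitTransport (mem_U1_of_unitary)
open MinimalActionSandwich (IsMinimiser admissible)
open MinimalActionRate (sfClass)
open MinimalActionExistence (exists_isMinimiser_of_nonempty)
open MinimalActionClassSixNeg (isUnitaryCfg_scalarCfg_imag norm_cexp_mul_I_smul_one_sub_one_le)
open Summit.QuantumFields.YangMills.BalabanUVNodes.N16SheetDatumPreimage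
open Summit.QuantumFields.YangMills.BalabanUVNodes.N16SheetDatum (mem_sfClass_of_sheetEqs hol_of_sheetEqs_of_dvd hol_of_sheetEqs_of_dvd_sub_one)
open Summit.QuantumFields.YangMills.BalabanUVNodes.N16SupKeyLetterFloor (dev_le_of_adjacent_of_covariantStep)

noncomputable section

variable {d : ℕ} {n : Type} [Fintype n] [DecidableEq n]

/-! ## §4 Kinematics of the graded sheet field: its plaquettes are the increments of the profile -/

section Kinematics

variable {F : B7Prop1Explicit.Site (d + 2) → Fin (d + 2) → ℂ} {a : ℤ → ℝ}
  (hF : ∀ (x : B7Prop1Explicit.Site (d + 2)) (κ : Fin (d + 2)), F x κ = if κ = 1 then ((a (x 0) : ℝ) : ℂ) * Complex.I else 0)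
include hF

/-- **THE PLAQUETTES OF THE GRADED SHEET FIELD**: `(e₀,e₁)`-plaquettes `e^{i(a(x₀+1) − a(x₀))}·1`, `(e₁,e₀)` ones the inverse, all others `1` — the field's
curvature is the INCREMENT of the profile. [cite: Balaban1985Averaging, (9) p.18, (44) p.24] -/
theorem hol_plaqWord_graded (x : B7Prop1Explicit.Site (d + 2)) (κ μ : Fin (d + 2)) :
    hol (scalarCfg (n := n) F) x (plaqWord κ μ)
      = expUnit ((((if κ = 0 ∧ μ = 1 then a (x 0 + 1) - a (x 0) else if κ = 1 ∧ μ = 0 then a (x 0) - a (x 0 + 1) else 0 : ℝ) : ℂ)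
          * Complex.I) • (1 : Matrix n n ℂ)) := by
  rw [hol_scalarCfg, asum_plaqWord]
  congr 2
  have hx0 : ∀ ν : Fin (d + 2), ((x + e ν) 0 : ℤ) = x 0 + if ν = 0 then 1 else 0 := by
    intro ν
    rw [Pi.add_apply, e_apply]
    by_cases h : ν = 0
    · rw [if_pos h, if_pos h.symm]
    · rw [if_neg h, if_neg (Ne.symm h)]
  rw [hF x κ, hF (x + e κ) μ, hF (x + e μ) κ, hF x μ, hx0 κ, hx0 μ]
  by_cases hκ0 : κ = 0 <;> by_cases hκ1 : κ = 1 <;> by_cases hμ0 : μ = 0 <;> by_cases hμ1 : μ = 1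
  all_goals (first | (exfalso; exact fin_zero_ne_one (hκ0.symm.trans hκ1)) | (exfalso; exact fin_zero_ne_one (hμ0.symm.trans hμ1)) | skip)
  all_goals (simp only [hκ0, hκ1, hμ0, hμ1, fin_zero_ne_one, fin_one_ne_zero, if_true, if_false, and_true, and_false, add_zero])
  all_goals (push_cast; ring)

/-- The graded sheet field is in the small-field class of radius `b` as soon as all increments `|a(t+1) − a(t)| ≤ b`. [folklore] -/
theorem smallField_graded [Nonempty n] {b : ℝ} (hb : ∀ t : ℤ, |a (t + 1) - a t| ≤ b) : SmallField (scalarCfg (n := n) F) b := by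
  intro x κ μ _
  rw [hol_plaqWord_graded hF, val_expUnit, ← cexp_smul_one]
  refine (norm_cexp_mul_I_smul_one_sub_one_le _).trans ?_
  have hb0 : 0 ≤ b := (abs_nonneg _).trans (hb 0)
  split_ifs
  · exact hb (x 0)
  · rw [abs_sub_comm]; exact hb (x 0)
  · rw [abs_zero]; exact hb0

/-- The graded sheet field is `P`-periodic when the profile is `P`-periodic. [folklore] -/
theorem isPeriodicCfg_graded {P : ℤ} (ha : ∀ t : ℤ, a (t + P) = a t) : IsPeriodicCfg (scalarCfg (n := n) F) P := by
  intro x κ μ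
  unfold scalarCfg
  congr 2
  rw [hF, hF]
  have : (x + P • e κ) 0 = x 0 + P * (if κ = 0 then 1 else 0) := by
    rw [Pi.add_apply, Pi.smul_apply, e_apply, smul_eq_mul]
    by_cases h : κ = 0
    · rw [if_pos h, if_pos h.symm]
    · rw [if_neg h, if_neg (Ne.symm h)]
  rw [this]
  by_cases h : κ = 0
  · rw [if_pos h, mul_one, ha]
  · rw [if_neg h, mul_zero, add_zero]

/-- The graded sheet field lies in the run-1 class `sfClass (d+2) L N ρ 1` as soon as its increments are `≤ ρ∕L²` and the profile is `(N·L)`-periodic. [folklore] -/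
theorem mem_sfClass_one_graded [Nonempty n] {L N : ℕ} {ρ : ℝ} (hb : ∀ t : ℤ, |a (t + 1) - a t| ≤ ρ / (L : ℝ) ^ 2)
    (ha : ∀ t : ℤ, a (t + (N : ℤ) * L) = a t) : scalarCfg (n := n) F ∈ sfClass (d + 2) L N ρ 1 := by
  -- unitarity: purely imaginary exponents (pub-balaban `isUnitaryCfg_scalarCfg_imag`; the statement shape is dag-n16-w2's `isUnitaryCfg_landau`)
  have hF' : F = fun x κ => (((if κ = 1 then a (x 0) else 0 : ℝ) : ℝ) : ℂ) * Complex.I := by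
    funext x κ; rw [hF x κ]; split_ifs <;> simp
  have hu : IsUnitaryCfg (scalarCfg (n := n) F) := by rw [hF']; exact isUnitaryCfg_scalarCfg_imag _
  refine ⟨hu, ?_, ?_⟩
  · have : ((N * L ^ 1 : ℕ) : ℤ) = (N : ℤ) * L := by push_cast; ring
    rw [this]
    exact isPeriodicCfg_graded hF ha
  · have : ρ / ((L : ℝ) ^ 1) ^ 2 = ρ / (L : ℝ) ^ 2 := by ring
    rw [this]
    exact smallField_graded hF hb

end Kinematics

/-! ## §5 ★★ The one-step average (43) of the graded sheet field with the block-parabola profile IS the sheet datum -/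

section Average

variable {L N : ℕ} {h : ℝ} {a : ℤ → ℝ} {F : B7Prop1Explicit.Site (d + 2) → Fin (d + 2) → ℂ}
  (hL : 2 ≤ L)
  (hc : ∀ t : ℤ, (N : ℤ) ∣ t / L → a t = h * ((t % L : ℤ) : ℝ) * ((L : ℝ) - ((t % L : ℤ) : ℝ)))
  (hu : ∀ t : ℤ, ¬ (N : ℤ) ∣ t / L → a t = 0)
  (hF : ∀ (x : B7Prop1Explicit.Site (d + 2)) (κ : Fin (d + 2)), F x κ = if κ = 1 then ((a (x 0) : ℝ) : ℂ) * Complex.I else 0)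
include hL hc hu hF

/-- **★★ THE AVERAGE (43) OF THE GRADED SHEET FIELD SOLVES THE SHEET EQUATIONS OF FILE 22a** (`μ₀ = e₀`, `ν₀ = e₁`, `w = e^{iφ}·1` with
`φ = h(L³ − L)∕6`): on the next unit lattice, `V(z, e_κ) = 1` for `κ ≠ 1` (the `e₀`-bond average is `1` because the profile VANISHES at every block start —
no coarse gauge is produced) and `V(z, e₁) = w` on the charged sheet `N ∣ z₀`, `= 1` off it (the block sums of the profile).  Log branch:
`0 ≤ h`, `2·L·(hL²) < ln 2`. [cite: Balaban1985Averaging, (42)–(43) pp.23–24] -/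
theorem rescale_bavg_graded_sheetEqs [Nonempty n] (hh : 0 ≤ h) (hlog : 2 * (L : ℝ) * (h * (L : ℝ) ^ 2) < Real.log 2) :
    (∀ (z : B7Prop1Explicit.Site (d + 2)) (κ : Fin (d + 2)), κ ≠ 1 → rescale L (bavg L (scalarCfg (n := n) F)) z κ = 1) ∧
    (∀ z : B7Prop1Explicit.Site (d + 2), rescale L (bavg L (scalarCfg (n := n) F)) z 1
      = if (N : ℤ) ∣ z 0 then expUnit ((((h * (((L : ℝ) ^ 3 - L) / 6) : ℝ) : ℂ) * Complex.I) • (1 : Matrix n n ℂ)) else 1) := by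
  have hL1 : 1 ≤ L := by omega
  have hM : ∀ t, |a t| ≤ h * (L : ℝ) ^ 2 := fun t => by
    obtain ⟨h0, h1⟩ := profile_bounds hL1 hc hu hh t
    rw [abs_of_nonneg h0]; exact h1
  have hone : expUnit ((((0 : ℝ) : ℂ) * Complex.I) • (1 : Matrix n n ℂ)) = 1 := by
    ext1; simp
  have hz0 : ∀ z : B7Prop1Explicit.Site (d + 2), (((L : ℤ) • z) 0 : ℤ) = (L : ℤ) * z 0 := fun z => by simp
  constructor
  · intro z κ hκ1
    rw [rescale_apply, bavg_graded hF L hL1 hM hlog, hz0]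
    by_cases hκ0 : κ = 0
    · rw [if_pos hκ0, profile_block_start hL1 hc hu (z 0),
        show (L : ℤ) * z 0 + L = (L : ℤ) * (z 0 + 1) by ring, profile_block_start hL1 hc hu (z 0 + 1)]
      simp only [sub_self, zero_mul, zero_div]
      exact hone
    · rw [if_neg hκ0, if_neg hκ1]; exact hone
  · intro z
    rw [rescale_apply, bavg_graded hF L hL1 hM hlog, hz0, if_neg fin_one_ne_zero, if_pos rfl, profile_block_sum hL1 hc hu (z 0)]
    split_ifs
    · rfl
    · exact hone

/-- **★ THE GRADED SHEET FIELD IS ADMISSIBLE FOR THE SHEET DATUM AT CLASS RADIUS `h(L−1)L²`**: it lies in `sfClass (d+2) L N ρ 1` for every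
`ρ ≥ h·(L−1)·L²` and its one-step average (43) is the sheet datum. [folklore] -/
theorem mem_admissible_graded [Nonempty n] (hh : 0 ≤ h) {ρ : ℝ} (hρ : h * ((L : ℝ) - 1) * (L : ℝ) ^ 2 ≤ ρ) :
    scalarCfg (n := n) F ∈ admissible (sfClass (d + 2) L N ρ) L 1 (rescale L (bavg L (scalarCfg (n := n) F))) := by
  have hL1 : 1 ≤ L := by omega
  have hL0 : (0 : ℝ) < L := by exact_mod_cast (show 0 < L by omega)
  refine ⟨mem_sfClass_one_graded hF (fun t => (profile_increment hL1 hc hu hh t).trans ?_) (profile_periodic hL1 hc hu), ?_⟩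
  · rw [le_div_iff₀ (by positivity)]; exact hρ
  · rw [avgIter_succ, avgIter_zero]

end Average

/-! ## §6 ★★ Existence of run-1 minimisers at the sheet datum WITHOUT the inflated radius -/

/-- **★★ AT THE SHEET DATUM OF AMPLITUDE `φ` A RUN-1 MINIMISER EXISTS FOR EVERY CLASS RADIUS `ρ ≥ 6φ`** (`L ≥ 2`, `0 ≤ φ ≤ 1∕32`, leaf-05's series
regime for `ρ`): there is a solution `V` of file 22a's sheet equations for `(N, e₀, e₁, w = e^{iφ}·1)` and a minimiser `U` of run 1 over
`sfClass (d+2) L N ρ 1` at `V`.  SOURCE: the graded sheet field with the block-parabola profile of amplitude `h = 6φ∕(L³ − L)` is admissible at radius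
`h(L−1)L² = 6φL∕(L+1) < 6φ` (§5); leaf-05's compactness `MinimalActionExistence.exists_isMinimiser_of_nonempty`.  Compare dag-n16-w2's
`…N16SlotKeyFlatModuli.exists_isMinimiser_inflated` (slice pullback, radius `ε₁L²` for an `ε₁`-datum) used by file 22b: here the radius is k-, L- and
N-UNIFORM, so file 22b's hypothesis `L² ≤ C.B₃` drops to `6 ≤ C.B₃` (file 22d). [cite: Balaban1985Variational, Thm 1 (8) p.279] -/
theorem exists_isMinimiser_sheet [Nonempty n] {L : ℕ} (hL : 2 ≤ L) (N : ℕ) {φ ρ : ℝ} (hφ0 : 0 ≤ φ) (hφ : φ ≤ 1 / 32)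
    (hρ : 6 * φ ≤ ρ) (he1 : 16 * C0 (d + 2) * ρ ≤ 3) (he2 : 1024 * (((d + 2 : ℕ) : ℝ) + 1) * (((d + 2 : ℕ) : ℝ) + 4) * (L : ℝ) ^ 2 * ρ ≤ 1) :
    ∃ V U : B7Prop1Explicit.Site (d + 2) → Fin (d + 2) → (Matrix n n ℂ)ˣ,
      (∀ (z : B7Prop1Explicit.Site (d + 2)) (κ : Fin (d + 2)), κ ≠ 1 → V z κ = 1) ∧
      (∀ z : B7Prop1Explicit.Site (d + 2), V z 1
        = if (N : ℤ) ∣ z 0 then expUnit ((((φ : ℝ) : ℂ) * Complex.I) • (1 : Matrix n n ℂ)) else 1) ∧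
      IsMinimiser (d + 2) (sfClass (d + 2) L N ρ) L N 1 V U := by
  have hL1 : (1 : ℝ) ≤ L := by exact_mod_cast (show 1 ≤ L by omega)
  have hL2 : (2 : ℝ) ≤ L := by exact_mod_cast hL
  have hL0 : (0 : ℝ) < L := by linarith
  have hLL : 0 < (L : ℝ) ^ 3 - L := by nlinarith
  -- the amplitude
  set h : ℝ := 6 * φ / ((L : ℝ) ^ 3 - L) with hhdef
  have hh : 0 ≤ h := by positivity
  have hL21 : (L : ℝ) ^ 2 - 1 ≠ 0 := (by nlinarith : (0 : ℝ) < (L : ℝ) ^ 2 - 1).ne'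
  have hLm1 : (L : ℝ) - 1 ≠ 0 := (by linarith : (0 : ℝ) < (L : ℝ) - 1).ne'
  have hLp1 : (L : ℝ) + 1 ≠ 0 := (by linarith : (0 : ℝ) < (L : ℝ) + 1).ne'
  have hφh : h * (((L : ℝ) ^ 3 - L) / 6) = φ := by rw [hhdef]; field_simp [hLL.ne']
  -- the profile and the field
  obtain ⟨a, hc, hu⟩ := exists_profile L N h
  set F : B7Prop1Explicit.Site (d + 2) → Fin (d + 2) → ℂ := fun x κ => if κ = 1 then ((a (x 0) : ℝ) : ℂ) * Complex.I else 0 with hFdef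
  have hF : ∀ (x : B7Prop1Explicit.Site (d + 2)) (κ : Fin (d + 2)), F x κ = if κ = 1 then ((a (x 0) : ℝ) : ℂ) * Complex.I else 0 :=
    fun x κ => rfl
  -- log branch: `2L·hL² = 12φL³/(L³−L) ≤ 16φ ≤ 1/2 < ln 2`
  have hlog : 2 * (L : ℝ) * (h * (L : ℝ) ^ 2) < Real.log 2 := by
    have h1 : 2 * (L : ℝ) * (h * (L : ℝ) ^ 2) = 12 * φ * ((L : ℝ) ^ 3 / ((L : ℝ) ^ 3 - L)) := by
      rw [hhdef]; field_simp; ring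
    have h2 : (L : ℝ) ^ 3 / ((L : ℝ) ^ 3 - L) ≤ 4 / 3 := by
      rw [div_le_div_iff₀ hLL (by norm_num)]; nlinarith
    have h3 : 12 * φ * ((L : ℝ) ^ 3 / ((L : ℝ) ^ 3 - L)) ≤ 16 * φ := by nlinarith
    have h4 : (16 : ℝ) * φ ≤ 1 / 2 := by linarith
    have h5 : (1 : ℝ) / 2 < Real.log 2 := by have := Real.log_two_gt_d9; linarith
    linarith
  -- radius: `h(L−1)L² = 6φL/(L+1) ≤ 6φ ≤ ρ`
  have hrad : h * ((L : ℝ) - 1) * (L : ℝ) ^ 2 ≤ ρ := by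
    have h1 : h * ((L : ℝ) - 1) * (L : ℝ) ^ 2 = 6 * φ * ((L : ℝ) / ((L : ℝ) + 1)) := by
      rw [hhdef]
      have : (L : ℝ) ^ 3 - L = (L : ℝ) * ((L : ℝ) - 1) * ((L : ℝ) + 1) := by ring
      rw [this]
      field_simp [hLm1, hLp1, hL0.ne']
    have h2 : (L : ℝ) / ((L : ℝ) + 1) ≤ 1 := by rw [div_le_one (by linarith)]; linarith
    rw [h1]; nlinarith
  have hsheet := rescale_bavg_graded_sheetEqs (n := n) hL hc hu hF hh hlog
  have hadm := mem_admissible_graded (n := n) hL hc hu hF hh hrad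
  have hρ0 : 0 ≤ ρ := by linarith
  obtain ⟨U, hU⟩ := exists_isMinimiser_of_nonempty hL hρ0 he1 he2 ⟨_, hadm⟩
  refine ⟨rescale L (bavg L (scalarCfg (n := n) F)), U, hsheet.1, fun z => ?_, hU⟩
  rw [hsheet.2 z, hφh]

/-! ## §7 ★★ THE FLOOR OF THE SUP KEY's GRADIENT LETTER, L-UNIFORMLY (`6 ≤ C.B₃`) -/
/-- ★★ **THE FLOOR FROM RUN ONE, L-UNIFORMLY**: in dimension `d + 2`, for `L ≥ 2`, `N ≥ 3` and constants with `6 ≤ C.B₃`, the `k = 0` instance of the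
sup key supKey(C, c) («every minimiser of run 1 over `sfClass (C.B₃ε₁) 1` at an `ε₁`-loose datum has covariant plaquette differences `≤ c·ε₁∕L³`») forces
`1 ≤ (4(d+2) + 9)·c`.  MECHANISM: the sheet datum of amplitude `φ = ε₁` (plaquette `e^{−iε₁}·1`, deviation `2 sin(ε₁∕2) ∈ [ε₁ − ε₁³∕16, ε₁]`, at the origin;
`1` at `e₀`) carries a run-1 minimiser over `sfClass (C.B₃ε₁) 1` by §6 (`6ε₁ ≤ C.B₃ε₁`), and file 22b's `dev_le_of_adjacent_of_covariantStep` gives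
`2 sin(ε₁∕2) ≤ (4(d+2)+9)cε₁ + 2K(C.B₃ε₁)²`; `ε₁ → 0⁺`. [cite: Balaban1985Variational, Thm 1 (8)–(10) p.279] -/
theorem one_le_of_supKey_runOne_of_six_le [Nonempty n] {L N : ℕ} (hL : 2 ≤ L) (hN : 3 ≤ N) (C : B11Thm1.Consts) (hB6 : 6 ≤ C.B₃) {c : ℝ}
    (hK0 : ∀ (ε₁ : ℝ), 0 < ε₁ → ε₁ ≤ C.a₁ → ∀ (V U : B7Prop1Explicit.Site (d + 2) → Fin (d + 2) → (Matrix n n ℂ)ˣ),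
      V ∈ sfClass (d + 2) L N ε₁ 0 → IsMinimiser (d + 2) (sfClass (d + 2) L N (C.B₃ * ε₁)) L N 1 V U →
        ∀ (x : B7Prop1Explicit.Site (d + 2)) (κ : Fin (d + 2)) (π : T4AveragingDeficitWall.Plane (d + 2)),
          ‖covGrad U (fun q => ((fhol U q : (Matrix n n ℂ)ˣ) : Matrix n n ℂ)) x κ π‖ ≤ c * ε₁ / (L : ℝ) ^ 3) :
    1 ≤ (4 * ((d + 2 : ℕ) : ℝ) + 9) * c := by
  have hB := C.B₃_pos
  have ha := C.a₁_pos
  have hL1 : 1 ≤ L := by omega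
  have hN2 : 2 ≤ N := by omega
  have hL0 : (0 : ℝ) < L := by exact_mod_cast (show 0 < L by omega)
  have hC0 := C0_pos (d + 2)
  have hD0 : (0 : ℝ) ≤ ((d + 2 : ℕ) : ℝ) := by positivity
  obtain ⟨K, hKdef⟩ : ∃ K : ℝ, K = 2 * (2 * ((d + 2 : ℕ) : ℝ) + 4) * (3 * ((d + 2 : ℕ) : ℝ) + 8)
      + 14464 * (((d + 2 : ℕ) : ℝ) + 1) ^ 2 * (((d + 2 : ℕ) : ℝ) + 4) ^ 2 := ⟨_, rfl⟩
  have hKpos : 0 < K := by rw [hKdef]; positivity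
  by_contra hcon
  push Not at hcon
  obtain ⟨δ, hδdef⟩ : ∃ δ : ℝ, δ = 1 - (4 * ((d + 2 : ℕ) : ℝ) + 9) * c := ⟨_, rfl⟩
  have hδ : 0 < δ := by rw [hδdef]; linarith
  -- the thresholds
  obtain ⟨t₁, ht₁⟩ : ∃ t : ℝ, t = 1 / (512 * (((d + 2 : ℕ) : ℝ) + 1) * (((d + 2 : ℕ) : ℝ) + 4) * C.B₃) := ⟨_, rfl⟩
  obtain ⟨t₂, ht₂⟩ : ∃ t : ℝ, t = 3 / (16 * C0 (d + 2) * C.B₃) := ⟨_, rfl⟩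
  obtain ⟨t₃, ht₃⟩ : ∃ t : ℝ, t = 1 / (1024 * (((d + 2 : ℕ) : ℝ) + 1) * (((d + 2 : ℕ) : ℝ) + 4) * (L : ℝ) ^ 2 * C.B₃) := ⟨_, rfl⟩
  obtain ⟨t₄, ht₄⟩ : ∃ t : ℝ, t = δ / (2 * (1 / 16 + 2 * K * C.B₃ ^ 2)) := ⟨_, rfl⟩
  have ht₁0 : 0 < t₁ := by rw [ht₁]; positivity
  have ht₂0 : 0 < t₂ := by rw [ht₂]; positivity
  have ht₃0 : 0 < t₃ := by rw [ht₃]; positivity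
  have ht₄0 : 0 < t₄ := by rw [ht₄]; positivity
  obtain ⟨ε₁, hε₁def⟩ : ∃ ε : ℝ, ε = min (min (min C.a₁ (1 / 32)) (min t₁ t₂)) (min t₃ t₄) := ⟨_, rfl⟩
  have hε : 0 < ε₁ := by rw [hε₁def]; exact lt_min (lt_min (lt_min ha (by norm_num)) (lt_min ht₁0 ht₂0)) (lt_min ht₃0 ht₄0)
  have hεa : ε₁ ≤ C.a₁ := by rw [hε₁def]; exact (min_le_left _ _).trans ((min_le_left _ _).trans (min_le_left _ _))
  have hε32 : ε₁ ≤ 1 / 32 := by rw [hε₁def]; exact (min_le_left _ _).trans ((min_le_left _ _).trans (min_le_right _ _))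
  have hεt₁ : ε₁ ≤ t₁ := by rw [hε₁def]; exact (min_le_left _ _).trans ((min_le_right _ _).trans (min_le_left _ _))
  have hεt₂ : ε₁ ≤ t₂ := by rw [hε₁def]; exact (min_le_left _ _).trans ((min_le_right _ _).trans (min_le_right _ _))
  have hεt₃ : ε₁ ≤ t₃ := by rw [hε₁def]; exact (min_le_right _ _).trans (min_le_left _ _)
  have hεt₄ : ε₁ ≤ t₄ := by rw [hε₁def]; exact (min_le_right _ _).trans (min_le_right _ _)
  have hε1 : ε₁ ≤ 1 := hε32.trans (by norm_num)
  have hρ0 : 0 ≤ C.B₃ * ε₁ := by positivity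
  have hsmall : 512 * (((d + 2 : ℕ) : ℝ) + 1) * (((d + 2 : ℕ) : ℝ) + 4) * (C.B₃ * ε₁) ≤ 1 := by
    rw [ht₁] at hεt₁
    have h := (le_div_iff₀ (by positivity : (0 : ℝ) < 512 * (((d + 2 : ℕ) : ℝ) + 1) * (((d + 2 : ℕ) : ℝ) + 4) * C.B₃)).mp hεt₁
    linarith
  have he1 : 16 * C0 (d + 2) * (C.B₃ * ε₁) ≤ 3 := by
    rw [ht₂] at hεt₂
    have h := (le_div_iff₀ (by positivity : (0 : ℝ) < 16 * C0 (d + 2) * C.B₃)).mp hεt₂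
    linarith
  have he2 : 1024 * (((d + 2 : ℕ) : ℝ) + 1) * (((d + 2 : ℕ) : ℝ) + 4) * (L : ℝ) ^ 2 * (C.B₃ * ε₁) ≤ 1 := by
    rw [ht₃] at hεt₃
    have h := (le_div_iff₀ (by positivity : (0 : ℝ) < 1024 * (((d + 2 : ℕ) : ℝ) + 1) * (((d + 2 : ℕ) : ℝ) + 4) * (L : ℝ) ^ 2 * C.B₃)).mp hεt₃
    linarith
  have ht4 : 2 * (1 / 16 + 2 * K * C.B₃ ^ 2) * ε₁ ≤ δ := by
    rw [ht₄] at hεt₄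
    have h := (le_div_iff₀ (by positivity : (0 : ℝ) < 2 * (1 / 16 + 2 * K * C.B₃ ^ 2))).mp hεt₄
    linarith
  -- the sheet datum of amplitude `ε₁` and its run-1 minimiser (§6)
  have h6ρ : 6 * ε₁ ≤ C.B₃ * ε₁ := mul_le_mul_of_nonneg_right hB6 hε.le
  obtain ⟨V, U, hV1, hV2, hU⟩ := exists_isMinimiser_sheet (n := n) hL N hε.le hε32 h6ρ he1 he2
  -- the phase `w = e^{iε₁}·1`: unitary, `‖w − 1‖ = 2 sin(ε₁/2) ∈ [ε₁ − ε₁³/16, ε₁]`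
  have hwval : ((expUnit ((((ε₁ : ℝ) : ℂ) * Complex.I) • (1 : Matrix n n ℂ)) : (Matrix n n ℂ)ˣ) : Matrix n n ℂ)
      = Complex.exp (((ε₁ : ℝ) : ℂ) * Complex.I) • (1 : Matrix n n ℂ) := by
    rw [val_expUnit, ← cexp_smul_one]
  have hw : expUnit ((((ε₁ : ℝ) : ℂ) * Complex.I) • (1 : Matrix n n ℂ)) ∈ unitaryUnits (Matrix n n ℂ) := by
    rw [mem_unitaryUnits, hwval]; exact smul_one_mem_unitary (Complex.norm_exp_ofReal_mul_I ε₁)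
  have hwle : ‖((expUnit ((((ε₁ : ℝ) : ℂ) * Complex.I) • (1 : Matrix n n ℂ)) : (Matrix n n ℂ)ˣ) : Matrix n n ℂ) - 1‖ ≤ ε₁ := by
    rw [hwval]; exact (norm_cexp_mul_I_smul_one_sub_one_le ε₁).trans (le_of_eq (abs_of_pos hε))
  have hwge : ε₁ - ε₁ ^ 3 / 16 ≤ ‖((expUnit ((((ε₁ : ℝ) : ℂ) * Complex.I) • (1 : Matrix n n ℂ)) : (Matrix n n ℂ)ˣ) : Matrix n n ℂ) - 1‖ := by
    rw [hwval, norm_smul_one_sub_one, show ((ε₁ : ℝ) : ℂ) * Complex.I = Complex.I * (ε₁ : ℝ) by ring,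
      Complex.norm_exp_I_mul_ofReal_sub_one]
    have hs : ε₁ / 2 - (ε₁ / 2) ^ 3 / 6 < Real.sin (ε₁ / 2) := Real.sin_gt_sub_cube (by positivity)
    have h2 : ε₁ - ε₁ ^ 3 / 16 ≤ 2 * Real.sin (ε₁ / 2) := by nlinarith [pow_pos hε 3]
    exact h2.trans ((le_abs_self _).trans (le_of_eq (Real.norm_eq_abs _).symm))
  -- the datum is `ε₁`-loose, its origin plaquette deviates by `≥ ε₁ − ε₁³/16`, its `e₀`-neighbour is `1`
  have hV : V ∈ sfClass (d + 2) L N ε₁ 0 := mem_sfClass_of_sheetEqs L hV1 hV2 hw hwle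
  have hV0 : ε₁ - ε₁ ^ 3 / 16 ≤ ‖((hol V 0 (plaqWord (0 : Fin (d + 2)) 1) : (Matrix n n ℂ)ˣ) : Matrix n n ℂ) - 1‖ := by
    rw [hol_of_sheetEqs_of_dvd hV1 hV2 hN2 fin_zero_ne_one (by simp : (N : ℤ) ∣ (0 : B7Prop1Explicit.Site (d + 2)) 0)]
    have h := norm_inv_sub_one_le ((U1 _).inv_mem (mem_U1_of_unitary hw))
    rw [inv_inv] at h
    exact hwge.trans h
  have hVe : hol V (e (0 : Fin (d + 2))) (plaqWord (0 : Fin (d + 2)) 1) = 1 :=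
    hol_of_sheetEqs_of_dvd_sub_one hV1 hV2 hN fin_zero_ne_one
      (by simp [e_apply] : (N : ℤ) ∣ (e (0 : Fin (d + 2)) : B7Prop1Explicit.Site (d + 2)) 0 - 1)
  -- the mechanism of file 22b
  have hlt : (0 : Fin (d + 2)) < 1 := Fin.mk_lt_mk.mpr zero_lt_one
  have hcore : ε₁ - ε₁ ^ 3 / 16 ≤ (4 * ((d + 2 : ℕ) : ℝ) + 9) * c * ε₁ + 2 * K * (C.B₃ * ε₁) ^ 2 := by
    rw [hKdef]
    exact dev_le_of_adjacent_of_covariantStep (n := n) hL1 hlt hρ0 hsmall hV0 hVe hU.mem.1 hU.mem.2 (hK0 ε₁ hε hεa V U hV hU)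
  -- `δ ε₁ ≤ ε₁³/16 + 2 K B² ε₁² ≤ ε₁² (1/16 + 2KB²)`, contradiction with `ht4`
  have h1 : δ * ε₁ ≤ ε₁ ^ 3 / 16 + 2 * K * C.B₃ ^ 2 * ε₁ ^ 2 := by
    have e : (4 * ((d + 2 : ℕ) : ℝ) + 9) * c * ε₁ = (1 - δ) * ε₁ := by rw [hδdef]; ring
    have e2 : 2 * K * (C.B₃ * ε₁) ^ 2 = 2 * K * C.B₃ ^ 2 * ε₁ ^ 2 := by ring
    rw [e, e2] at hcore
    linarith only [hcore]
  have h2 : ε₁ ^ 3 ≤ ε₁ ^ 2 := by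
    have : ε₁ ^ 3 = ε₁ ^ 2 * ε₁ := by ring
    rw [this]; exact mul_le_of_le_one_right (sq_nonneg _) hε1
  have h3 : δ * ε₁ ≤ ((1 / 16 + 2 * K * C.B₃ ^ 2) * ε₁) * ε₁ := by
    have e3 : ((1 / 16 + 2 * K * C.B₃ ^ 2) * ε₁) * ε₁ = ε₁ ^ 2 / 16 + 2 * K * C.B₃ ^ 2 * ε₁ ^ 2 := by ring
    rw [e3]
    linarith only [h1, h2]
  have h4 : δ ≤ (1 / 16 + 2 * K * C.B₃ ^ 2) * ε₁ := le_of_mul_le_mul_right h3 hε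
  linarith only [h4, ht4, hδ]

/-- ★★ **THE FLOOR, L-UNIFORMLY**: under the same hypotheses, with the sup key displayed VERBATIM (all runs `k+1`) as in files 19–22b at dimension `d + 2`:
`1∕(4(d+2)+9) ≤ c` whenever `6 ≤ C.B₃` — file 22b's `supKey_letter_floor` with `L² ≤ C.B₃` replaced by the L-uniform `6 ≤ C.B₃`.
[cite: Balaban1985Variational, Thm 1 (8)–(10) p.279] -/
theorem supKey_letter_floor_of_six_le [Nonempty n] {L N : ℕ} (hL : 2 ≤ L) (hN : 3 ≤ N) (C : B11Thm1.Consts) (hB6 : 6 ≤ C.B₃) {c : ℝ}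
    (hK : ∀ (k : ℕ) (ε₁ : ℝ), 0 < ε₁ → ε₁ ≤ C.a₁ → ∀ (V U : B7Prop1Explicit.Site (d + 2) → Fin (d + 2) → (Matrix n n ℂ)ˣ),
      V ∈ sfClass (d + 2) L N ε₁ 0 → IsMinimiser (d + 2) (sfClass (d + 2) L N (C.B₃ * ε₁)) L N (k + 1) V U →
        ∀ (x : B7Prop1Explicit.Site (d + 2)) (κ : Fin (d + 2)) (π : T4AveragingDeficitWall.Plane (d + 2)),
          ‖covGrad U (fun q => ((fhol U q : (Matrix n n ℂ)ˣ) : Matrix n n ℂ)) x κ π‖ ≤ c * ε₁ / ((L : ℝ) ^ (k + 1)) ^ 3) :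
    1 / (4 * ((d + 2 : ℕ) : ℝ) + 9) ≤ c := by
  have h := one_le_of_supKey_runOne_of_six_le (n := n) hL hN C hB6 (c := c) fun ε₁ hε hεa V U hV hU x κ π => by
    have h := hK 0 ε₁ hε hεa V U hV hU x κ π
    simpa only [zero_add, pow_one] using h
  rw [div_le_iff₀ (by positivity : (0 : ℝ) < 4 * ((d + 2 : ℕ) : ℝ) + 9)]
  linarith

/-- ★ **THE SUP KEY IS FALSE BELOW THE FLOOR FOR EVERY `C.B₃ ≥ 6`** (dimension `d + 2`, `L ≥ 2`, `N ≥ 3`; at the record `d + 2 = 4`: every `c < 1∕25`).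
Nothing is said at or above the floor, nor for `C.B₃ < 6` (node N07's content). [cite: Balaban1985Variational, Thm 1 (8)–(10) p.279] -/
theorem not_supKey_of_lt_floor_of_six_le [Nonempty n] {L N : ℕ} (hL : 2 ≤ L) (hN : 3 ≤ N) (C : B11Thm1.Consts) (hB6 : 6 ≤ C.B₃) {c : ℝ}
    (hc : c < 1 / (4 * ((d + 2 : ℕ) : ℝ) + 9)) :
    ¬ (∀ (k : ℕ) (ε₁ : ℝ), 0 < ε₁ → ε₁ ≤ C.a₁ → ∀ (V U : B7Prop1Explicit.Site (d + 2) → Fin (d + 2) → (Matrix n n ℂ)ˣ),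
      V ∈ sfClass (d + 2) L N ε₁ 0 → IsMinimiser (d + 2) (sfClass (d + 2) L N (C.B₃ * ε₁)) L N (k + 1) V U →
        ∀ (x : B7Prop1Explicit.Site (d + 2)) (κ : Fin (d + 2)) (π : T4AveragingDeficitWall.Plane (d + 2)),
          ‖covGrad U (fun q => ((fhol U q : (Matrix n n ℂ)ˣ) : Matrix n n ℂ)) x κ π‖ ≤ c * ε₁ / ((L : ℝ) ^ (k + 1)) ^ 3) :=
  fun hK => absurd (supKey_letter_floor_of_six_le hL hN C hB6 hK) (not_le.mpr hc)

/-- ★ **AT THE RECORD's DIMENSION FOUR**: for `L ≥ 2`, `N ≥ 3`, `6 ≤ C.B₃` the displayed N07-edge sup key on `ℤ⁴`-configurations is FALSE for every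
`c < 1∕25` (`4·4 + 9 = 25`). [cite: Balaban1985Variational, Thm 1 (8)–(10) p.279] -/
theorem not_supKey_dim_four_of_lt [Nonempty n] {L N : ℕ} (hL : 2 ≤ L) (hN : 3 ≤ N) (C : B11Thm1.Consts) (hB6 : 6 ≤ C.B₃) {c : ℝ}
    (hc : c < 1 / 25) :
    ¬ (∀ (k : ℕ) (ε₁ : ℝ), 0 < ε₁ → ε₁ ≤ C.a₁ → ∀ (V U : B7Prop1Explicit.Site 4 → Fin 4 → (Matrix n n ℂ)ˣ),
      V ∈ sfClass 4 L N ε₁ 0 → IsMinimiser 4 (sfClass 4 L N (C.B₃ * ε₁)) L N (k + 1) V U →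
        ∀ (x : B7Prop1Explicit.Site 4) (κ : Fin 4) (π : T4AveragingDeficitWall.Plane 4),
          ‖covGrad U (fun q => ((fhol U q : (Matrix n n ℂ)ˣ) : Matrix n n ℂ)) x κ π‖ ≤ c * ε₁ / ((L : ℝ) ^ (k + 1)) ^ 3) :=
  not_supKey_of_lt_floor_of_six_le (d := 2) (n := n) hL hN C hB6 (by norm_num; linarith)

end

end Summit.QuantumFields.YangMills.BalabanUVNodes.N16SupKeyLetterFloorUniform
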